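import Literature.MathematicalPhysics.QuantumManyBody.GroundState
import Summits.AtomisticToContinuum.BoseEinsteinCondensation.Theorems.BECCutLineWeakDisorderGroundStateRigidityUniqueOfRigid
import Summits.AtomisticToContinuum.BoseEinsteinCondensation.Theorems.BECCutLineWeakDisorderGroundStateRigidityStubExistsNonnegGroundState
import HarnessLib

/-!
# Crux `GroundStateRigidity` (stmt-AtomisticToContinuum-9072), line `Sketch`:
# the registered stub `stub_uniqueOfPos`

Supports (does not close) stmt-AtomisticToContinuum-9072; stub `stub_uniqueOfPos` of line Sketch
(lead c2). **Uniqueness of the closed-form ground state up to a constant phase from a.e.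
positivity of nonnegative ground states** (the lattice/sign argument of Reed–Simon IV §XIII.12,
Thm XIII.44, run on the cone of closed-form minimisers of `GroundState.lean`). Inputs, both as
hypotheses: (i) `hlin` — a normalised linear combination of two ground states is a ground state
(the registered statement of the neighbouring stub `stub_lincombGroundState`, NOT re-proved);
(ii) `hpos` — every nonnegative real ground state is a.e. strictly positive on the box.

Proof. (1) The modulus `|Θ|` of a ground state is a ground state (`isGroundState_modulus`:
near-minimising trial states `Φₙ → Θ`, `exists_trialState_near`, have regularised moduli
converging to `|Θ|` with no larger energy, `ExistsNonneg.exists_tendstoL2_norm`). (2) Sign lemma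
(`pos_or_neg`): a REAL ground state `g` is a.e. `> 0` on the box or a.e. `< 0` on the box —
`g⁺ = (|g| + g)/2`, unless a.e. zero, is after normalisation a nonnegative ground state (`hlin`
with `|g|`, `g`), so `g > 0` a.e. on the box by `hpos`; otherwise `g ≤ 0` a.e. and the same for
`−g`. (3) Two nonnegative ground states `P, Q` agree a.e. (`ae_eq_of_nonneg`): else
`(P − Q)/‖P − Q‖₂` is a real ground state (`hlin`) of strict sign on the box, contradicting
`∫ P² = ∫ Q² = 1`. (4) For a ground state `Θ` and the nonnegative one `Ψ₀`: `|Θ| = Ψ₀` a.e., and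
for `u ∈ {1, i}` the modulus of the normalised `Θ + u Ψ₀` is again `Ψ₀` a.e., i.e.
`|Θ + u Ψ₀| = r_u Ψ₀`; so wherever `Ψ₀ > 0` the quotient `Θ/Ψ₀` has modulus `1`, real part
`(r₁² − 2)/2` and imaginary part `(r_i² − 2)/2`: `Θ = c Ψ₀` a.e. with `|c| = 1`
(`exists_ae_eq_const_mul`). Two ground states `c₁ Ψ₀`, `c₂ Ψ₀` then differ by the phase
`c₂ conj c₁`.
-/

noncomputable section

open MeasureTheory Filter
open scoped ENNReal NNReal Topology ComplexConjugate

namespace Summit.AtomisticToContinuum.BoseEinsteinCondensation.Theorems.GroundStateRigidity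

open Literature.MathematicalPhysics.QuantumManyBody.BoseGas

namespace UniqueOfPos

variable {N : ℕ} {v : ℝ → ℝ≥0∞} {L : ℝ}

/-- Transport of `IsGroundState` along a pointwise identity of wave functions. [folklore] -/
theorem isGroundState_congr {Ψ Φ : Config N → ℂ} (hΨ : IsGroundState v L Ψ)
    (h : ∀ X, Ψ X = Φ X) : IsGroundState v L Φ := by
  have hfun : Ψ = Φ := funext h
  subst hfun
  exact hΨ

/-- `∫ |F|² = 0` forces `F = 0` a.e. (`F` measurable). [folklore] -/
theorem ae_eq_zero_of_lintegral_eq_zero {F : Config N → ℂ} (hF : Measurable F)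
    (h : ∫⁻ X, (‖F X‖₊ : ℝ≥0∞) ^ 2 = 0) : ∀ᵐ X : Config N, F X = 0 := by
  have hm : Measurable fun X => (‖F X‖₊ : ℝ≥0∞) ^ 2 :=
    (hF.nnnorm.coe_nnreal_ennreal).pow_const 2
  filter_upwards [(lintegral_eq_zero_iff hm).1 h] with X hX
  have h0 : (‖F X‖₊ : ℝ≥0∞) = 0 := by simpa using hX
  simpa using h0

/-- A ground state is not a.e. zero (it is normalised). [folklore] -/
theorem not_ae_eq_zero {Θ : Config N → ℂ} (hΘ : IsGroundState v L Θ)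
    (h : ∀ᵐ X : Config N, Θ X = 0) : False := by
  have h0 : ∫⁻ X, (‖Θ X‖₊ : ℝ≥0∞) ^ 2 = 0 := by
    refine (lintegral_congr_ae (h.mono fun X hX => ?_)).trans lintegral_zero
    show (‖Θ X‖₊ : ℝ≥0∞) ^ 2 = 0
    simp [hX]
  exact one_ne_zero (hΘ.norm_eq.symm.trans h0)

/-- If a ground state exists, the box `Λ_L^N` has positive measure (a ground state vanishes off the
box and is not a.e. zero). [folklore] -/
theorem volume_boxN_ne_zero {Θ : Config N → ℂ} (hΘ : IsGroundState v L Θ) :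
    volume (boxN N L) ≠ 0 := fun h0 =>
  not_ae_eq_zero hΘ ((measure_eq_zero_iff_ae_notMem.1 h0).mono fun X hX => hΘ.eq_zero X hX)

/-- `∫ |A + B|² < ⊤` when `∫ |A|² = ∫ |B|² = 1` (parallelogram bound). [folklore] -/
theorem lintegral_nnnorm_add_sq_ne_top {A B : Config N → ℂ} (hB : Measurable B)
    (hA1 : ∫⁻ X, (‖A X‖₊ : ℝ≥0∞) ^ 2 = 1) (hB1 : ∫⁻ X, (‖B X‖₊ : ℝ≥0∞) ^ 2 = 1) :
    ∫⁻ X, (‖A X + B X‖₊ : ℝ≥0∞) ^ 2 ≠ ⊤ := by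
  have hmB : Measurable fun X => 2 * (‖B X‖₊ : ℝ≥0∞) ^ 2 :=
    ((hB.nnnorm.coe_nnreal_ennreal).pow_const 2).const_mul 2
  have hle : ∫⁻ X, (‖A X + B X‖₊ : ℝ≥0∞) ^ 2 ≤ 2 * 1 + 2 * 1 :=
    calc ∫⁻ X, (‖A X + B X‖₊ : ℝ≥0∞) ^ 2
        ≤ ∫⁻ X, 2 * (‖A X‖₊ : ℝ≥0∞) ^ 2 + 2 * (‖B X‖₊ : ℝ≥0∞) ^ 2 :=
          lintegral_mono fun X => coe_nnnorm_add_sq_le _ _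
      _ = 2 * 1 + 2 * 1 := by
          rw [lintegral_add_right _ hmB, lintegral_const_mul' _ _ ENNReal.ofNat_ne_top,
            lintegral_const_mul' _ _ ENNReal.ofNat_ne_top, hA1, hB1]
  exact ne_top_of_le_ne_top (by norm_num) hle

/-- Normalisation: if `0 < ∫ |F|² < ⊤` then `∫ |s F|² = 1` for some real `s > 0`
(`s = (∫ |F|²)^{-1/2}`). [folklore] -/
theorem exists_normalise {F : Config N → ℂ} (hm : ∫⁻ X, (‖F X‖₊ : ℝ≥0∞) ^ 2 ≠ 0)
    (hmt : ∫⁻ X, (‖F X‖₊ : ℝ≥0∞) ^ 2 ≠ ⊤) :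
    ∃ s : ℝ, 0 < s ∧ ∫⁻ X, (‖(s : ℂ) * F X‖₊ : ℝ≥0∞) ^ 2 = 1 := by
  set m : ℝ≥0∞ := ∫⁻ X, (‖F X‖₊ : ℝ≥0∞) ^ 2 with hm_def
  refine ⟨Real.sqrt (m.toReal)⁻¹, Real.sqrt_pos.2 (inv_pos.2 (ENNReal.toReal_pos hm hmt)), ?_⟩
  have hc2 : (‖((Real.sqrt (m.toReal)⁻¹ : ℝ) : ℂ)‖₊ : ℝ≥0∞) ^ 2 = m⁻¹ := by
    rw [ExistsNonneg.coe_nnnorm_ofReal_sq, Real.sq_sqrt (inv_nonneg.2 ENNReal.toReal_nonneg),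
      ENNReal.ofReal_inv_of_pos (ENNReal.toReal_pos hm hmt), ENNReal.ofReal_toReal hmt]
  have hsq : ∀ X, (‖((Real.sqrt (m.toReal)⁻¹ : ℝ) : ℂ) * F X‖₊ : ℝ≥0∞) ^ 2 =
      m⁻¹ * (‖F X‖₊ : ℝ≥0∞) ^ 2 := fun X => by
    rw [nnnorm_mul, ENNReal.coe_mul, mul_pow, hc2]
  simp_rw [hsq]
  rw [lintegral_const_mul' _ _ (ENNReal.inv_ne_top.2 hm), ENNReal.inv_mul_cancel hm hmt]

/-- **The modulus of a ground state is a ground state** (diamagnetic inequality): near-minimising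
trial states `Φₙ → Θ` (`exists_trialState_near` with slack and tolerance `1/(n+1)`) have
normalised regularised moduli converging to `|Θ|` in `L²` with `liminf` energy `≤ E₀`
(`ExistsNonneg.exists_tendstoL2_norm`), so `|Θ|` is a ground state (`IsGroundState.of_tendstoL2`).
[cite: ReedSimonIV1978, §XIII.12 Thm XIII.46] -/
theorem isGroundState_modulus {Θ : Config N → ℂ} (hΘ : IsGroundState v L Θ) :
    IsGroundState v L (fun X => ((‖Θ X‖ : ℝ) : ℂ)) := by
  have hE : groundStateEnergy v N L ≠ ⊤ := hΘ.groundStateEnergy_ne_top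
  have hpos : ∀ n : ℕ, (0 : ℝ≥0∞) < ((n + 1 : ℕ) : ℝ≥0∞)⁻¹ := fun n =>
    ENNReal.inv_pos.2 (ENNReal.natCast_ne_top _)
  have hex : ∀ n : ℕ, ∃ T : TrialState N L,
      energy v T ≤ groundStateEnergy v N L + ((n + 1 : ℕ) : ℝ≥0∞)⁻¹ ∧
        ∫⁻ X, (‖T.ψ X - Θ X‖₊ : ℝ≥0∞) ^ 2 ≤ ((n + 1 : ℕ) : ℝ≥0∞)⁻¹ := fun n =>
    exists_trialState_near hΘ (hpos n) (hpos n)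
  choose Φ hΦE hΦd using hex
  have htend : Tendsto (fun n : ℕ => ((n + 1 : ℕ) : ℝ≥0∞)⁻¹) atTop (𝓝 0) :=
    ENNReal.tendsto_inv_nat_nhds_zero.comp (tendsto_add_atTop_nat 1)
  have hL2 : TendstoL2 Φ Θ :=
    tendsto_of_tendsto_of_tendsto_of_le_of_le tendsto_const_nhds htend (fun _ => zero_le) hΦd
  have hb : Tendsto (fun n : ℕ => groundStateEnergy v N L + ((n + 1 : ℕ) : ℝ≥0∞)⁻¹) atTop
      (𝓝 (groundStateEnergy v N L)) := by
    have h := htend.const_add (groundStateEnergy v N L)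
    rwa [add_zero] at h
  obtain ⟨Ξ, hΞ, hlim⟩ := ExistsNonneg.exists_tendstoL2_norm v hΘ.measurable hL2 hb hΦE
  exact IsGroundState.of_tendstoL2 (Complex.measurable_ofReal.comp hΘ.measurable.norm)
    (fun X hX => by simp [hΘ.eq_zero X hX]) (fun σ X => by simp only [hΘ.symm σ X]) hE hΞ hlim

/-- Two nonnegative ground states cannot be strictly ordered a.e. on the box: both have
`∫ |·|² = 1`, both vanish off the box, and the box has positive measure. [folklore] -/
theorem not_lt_of_nonneg {P Q : Config N → ℝ} (hQ0 : ∀ X, 0 ≤ Q X)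
    (hP : IsGroundState v L (fun X => (P X : ℂ))) (hQ : IsGroundState v L (fun X => (Q X : ℂ)))
    (hlt : ∀ᵐ X : Config N, X ∈ boxN N L → Q X < P X) : False := by
  have hle : (fun X => (‖(Q X : ℂ)‖₊ : ℝ≥0∞) ^ 2) ≤ᵐ[volume]
      fun X => (‖(P X : ℂ)‖₊ : ℝ≥0∞) ^ 2 := by
    filter_upwards [hlt] with X hX
    show (‖(Q X : ℂ)‖₊ : ℝ≥0∞) ^ 2 ≤ (‖(P X : ℂ)‖₊ : ℝ≥0∞) ^ 2
    by_cases hmem : X ∈ boxN N L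
    · rw [ExistsNonneg.coe_nnnorm_ofReal_sq, ExistsNonneg.coe_nnnorm_ofReal_sq]
      exact ENNReal.ofReal_le_ofReal (pow_le_pow_left₀ (hQ0 X) (hX hmem).le 2)
    · have hq : Q X = 0 := Complex.ofReal_eq_zero.1 (hQ.eq_zero X hmem)
      have hp : P X = 0 := Complex.ofReal_eq_zero.1 (hP.eq_zero X hmem)
      rw [hq, hp]
  have hlt' : ∀ᵐ X : Config N, X ∈ boxN N L →
      (‖(Q X : ℂ)‖₊ : ℝ≥0∞) ^ 2 < (‖(P X : ℂ)‖₊ : ℝ≥0∞) ^ 2 := by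
    filter_upwards [hlt] with X hX hmem
    have h := hX hmem
    have hP0 : 0 < P X := (hQ0 X).trans_lt h
    rw [ExistsNonneg.coe_nnnorm_ofReal_sq, ExistsNonneg.coe_nnnorm_ofReal_sq]
    exact (ENNReal.ofReal_lt_ofReal_iff (pow_pos hP0 2)).2
      (pow_lt_pow_left₀ h (hQ0 X) two_ne_zero)
  have h := lintegral_strict_mono_of_ae_le_of_ae_lt_on
    ((hP.measurable.nnnorm.coe_nnreal_ennreal).pow_const 2).aemeasurable
    (by rw [hQ.norm_eq]; exact ENNReal.one_ne_top) hle (volume_boxN_ne_zero hP) hlt'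
  rw [hQ.norm_eq, hP.norm_eq] at h
  exact lt_irrefl _ h

/-! ### Consequences of `hlin` and `hpos` -/

section Lincomb

variable
  (hlin : ∀ (N : ℕ) (v : ℝ → ℝ≥0∞) (L : ℝ) (Ψ Φ : Config N → ℂ) (a b : ℂ),
    IsGroundState v L Ψ → IsGroundState v L Φ →
    ∫⁻ X, (‖a * Ψ X + b * Φ X‖₊ : ℝ≥0∞) ^ 2 = 1 →
    IsGroundState v L (fun X => a * Ψ X + b * Φ X))
  (hpos : ∀ Ψ₀ : Config N → ℝ, (∀ X, 0 ≤ Ψ₀ X) → IsGroundState v L (fun X => (Ψ₀ X : ℂ)) →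
    ∀ᵐ X : Config N, X ∈ boxN N L → 0 < Ψ₀ X)

include hlin hpos

/-- Half of the sign lemma: a real ground state `g` is a.e. positive on the box or a.e.
nonpositive. `g⁺ = (|g| + g)/2`, if not a.e. zero, is after normalisation a nonnegative ground
state (`hlin` applied to the ground states `|g|` and `g`), hence a.e. positive on the box (`hpos`),
and `|g| + g > 0 ↔ g > 0`. [cite: ReedSimonIV1978, §XIII.12 Thm XIII.44] -/
theorem pos_or_nonpos {g : Config N → ℝ} (hG : IsGroundState v L (fun X => (g X : ℂ))) :
    (∀ᵐ X : Config N, X ∈ boxN N L → 0 < g X) ∨ (∀ᵐ X : Config N, g X ≤ 0) := by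
  have hA := isGroundState_modulus hG
  have hFm : Measurable fun X => ((‖(g X : ℂ)‖ : ℝ) : ℂ) + (g X : ℂ) :=
    hA.measurable.add hG.measurable
  set m : ℝ≥0∞ := ∫⁻ X, (‖((‖(g X : ℂ)‖ : ℝ) : ℂ) + (g X : ℂ)‖₊ : ℝ≥0∞) ^ 2 with hm_def
  by_cases hm : m = 0
  · right
    filter_upwards [ae_eq_zero_of_lintegral_eq_zero hFm hm] with X hX
    rw [Complex.norm_real, Real.norm_eq_abs, ← Complex.ofReal_add, Complex.ofReal_eq_zero] at hX
    linarith [abs_nonneg (g X)]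
  · left
    have hmt : m ≠ ⊤ := lintegral_nnnorm_add_sq_ne_top hG.measurable hA.norm_eq hG.norm_eq
    obtain ⟨s, hs0, h1⟩ := exists_normalise hm hmt
    simp_rw [mul_add] at h1
    have hgs := hlin N v L _ _ (s : ℂ) (s : ℂ) hA hG h1
    have hgs' : IsGroundState v L (fun X => ((s * (|g X| + g X) : ℝ) : ℂ)) :=
      isGroundState_congr hgs fun X => by
        simp only [Complex.norm_real, Real.norm_eq_abs]
        push_cast
        ring
    have hP : ∀ᵐ X : Config N, X ∈ boxN N L → 0 < s * (|g X| + g X) :=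
      hpos (fun X => s * (|g X| + g X))
        (fun X => mul_nonneg hs0.le (by linarith [neg_abs_le (g X)])) hgs'
    filter_upwards [hP] with X hX hmem
    have h2 : 0 < |g X| + g X := pos_of_mul_pos_right (hX hmem) hs0.le
    by_contra h3
    rw [abs_of_nonpos (le_of_not_gt h3)] at h2
    linarith

/-- **Sign lemma**: a real ground state is a.e. strictly positive on the box or a.e. strictly
negative on the box (`pos_or_nonpos` for `g` and `−g`; `g ≤ 0 ∧ g ≥ 0` a.e. would make the
normalised `g` vanish a.e.). [cite: ReedSimonIV1978, §XIII.12 Thm XIII.44] -/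
theorem pos_or_neg {g : Config N → ℝ} (hG : IsGroundState v L (fun X => (g X : ℂ))) :
    (∀ᵐ X : Config N, X ∈ boxN N L → 0 < g X) ∨ (∀ᵐ X : Config N, X ∈ boxN N L → g X < 0) := by
  rcases pos_or_nonpos hlin hpos hG with h | h
  · exact Or.inl h
  have hG' : IsGroundState v L (fun X => ((-g X : ℝ) : ℂ)) :=
    isGroundState_congr (hG.const_mul (c := -1) (by simp)) fun X => by push_cast; ring
  rcases pos_or_nonpos hlin hpos hG' with h' | h'
  · exact Or.inr (h'.mono fun X hX hmem => by linarith [hX hmem])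
  · exfalso
    refine not_ae_eq_zero hG ?_
    filter_upwards [h, h'] with X h1 h2
    have h0 : g X = 0 := le_antisymm h1 (by linarith)
    simp [h0]

/-- **Two nonnegative ground states agree a.e.**: otherwise `(P − Q)/‖P − Q‖₂` is a real ground
state (`hlin`), hence of strict sign a.e. on the box (`pos_or_neg`), contradicting
`∫ P² = ∫ Q² = 1` (`not_lt_of_nonneg`). [cite: ReedSimonIV1978, §XIII.12 Thm XIII.44] -/
theorem ae_eq_of_nonneg {P Q : Config N → ℝ} (hP0 : ∀ X, 0 ≤ P X) (hQ0 : ∀ X, 0 ≤ Q X)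
    (hP : IsGroundState v L (fun X => (P X : ℂ))) (hQ : IsGroundState v L (fun X => (Q X : ℂ))) :
    ∀ᵐ X : Config N, P X = Q X := by
  by_contra hne
  have hQ' := hQ.const_mul (c := (-1 : ℂ)) (by simp)
  have hFm : Measurable fun X => (P X : ℂ) + (-1) * (Q X : ℂ) := hP.measurable.add hQ'.measurable
  set m : ℝ≥0∞ := ∫⁻ X, (‖(P X : ℂ) + (-1) * (Q X : ℂ)‖₊ : ℝ≥0∞) ^ 2 with hm_def
  have hm : m ≠ 0 := by
    intro h0
    apply hne
    filter_upwards [ae_eq_zero_of_lintegral_eq_zero hFm h0] with X hX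
    have h1 : ((P X - Q X : ℝ) : ℂ) = 0 := by rw [← hX]; push_cast; ring
    exact sub_eq_zero.1 (Complex.ofReal_eq_zero.1 h1)
  have hmt : m ≠ ⊤ := lintegral_nnnorm_add_sq_ne_top hQ'.measurable hP.norm_eq hQ'.norm_eq
  obtain ⟨s, hs0, h1⟩ := exists_normalise hm hmt
  simp_rw [mul_add] at h1
  have hgs := hlin N v L _ _ (s : ℂ) (s : ℂ) hP hQ' h1
  have hgs' : IsGroundState v L (fun X => ((s * (P X - Q X) : ℝ) : ℂ)) :=
    isGroundState_congr hgs fun X => by push_cast; ring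
  rcases pos_or_neg hlin hpos hgs' with h | h
  · refine not_lt_of_nonneg hQ0 hP hQ (h.mono fun X hX hmem => ?_)
    have h2 : 0 < P X - Q X := pos_of_mul_pos_right (hX hmem) hs0.le
    linarith
  · refine not_lt_of_nonneg hP0 hQ hP (h.mono fun X hX hmem => ?_)
    have h2 : s * (P X - Q X) < 0 := hX hmem
    nlinarith [h2, hs0]

/-- For a ground state `Θ`, a nonnegative ground state `Ψ₀` and a unit `u`:
`|Θ + u Ψ₀| = r Ψ₀` a.e. for some real `r` — if `Θ + u Ψ₀` is not a.e. zero, its normalisation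
`s (Θ + u Ψ₀)` is a ground state (`hlin`), whose modulus is a nonnegative ground state
(`isGroundState_modulus`), a.e. equal to `Ψ₀` (`ae_eq_of_nonneg`); `r = 1/s`. [folklore] -/
theorem exists_norm_add_eq {Ψ₀ : Config N → ℝ} (hΨ₀0 : ∀ X, 0 ≤ Ψ₀ X)
    (hΨ₀ : IsGroundState v L (fun X => (Ψ₀ X : ℂ))) {Θ : Config N → ℂ}
    (hΘ : IsGroundState v L Θ) {u : ℂ} (hu : ‖u‖ = 1) :
    ∃ r : ℝ, ∀ᵐ X : Config N, ‖Θ X + u * Ψ₀ X‖ = r * Ψ₀ X := by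
  have hU := hΨ₀.const_mul hu
  have hFm : Measurable fun X => Θ X + u * (Ψ₀ X : ℂ) := hΘ.measurable.add hU.measurable
  set m : ℝ≥0∞ := ∫⁻ X, (‖Θ X + u * (Ψ₀ X : ℂ)‖₊ : ℝ≥0∞) ^ 2 with hm_def
  by_cases hm : m = 0
  · refine ⟨0, ?_⟩
    filter_upwards [ae_eq_zero_of_lintegral_eq_zero hFm hm] with X hX
    rw [hX, norm_zero, zero_mul]
  have hmt : m ≠ ⊤ := lintegral_nnnorm_add_sq_ne_top hU.measurable hΘ.norm_eq hU.norm_eq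
  obtain ⟨s, hs0, h1⟩ := exists_normalise hm hmt
  simp_rw [mul_add] at h1
  have hgs := hlin N v L _ _ (s : ℂ) (s : ℂ) hΘ hU h1
  have hmod := isGroundState_modulus hgs
  have hae : ∀ᵐ X : Config N, ‖(s : ℂ) * Θ X + (s : ℂ) * (u * (Ψ₀ X : ℂ))‖ = Ψ₀ X :=
    ae_eq_of_nonneg hlin hpos
      (P := fun X => ‖(s : ℂ) * Θ X + (s : ℂ) * (u * (Ψ₀ X : ℂ))‖) (fun X => norm_nonneg _)
      hΨ₀0 hmod hΨ₀
  refine ⟨s⁻¹, ?_⟩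
  filter_upwards [hae] with X hX
  rw [← mul_add, norm_mul, Complex.norm_real, Real.norm_of_nonneg hs0.le] at hX
  rw [eq_inv_mul_iff_mul_eq₀ hs0.ne']
  exact hX

/-- **Every ground state is a constant phase times the nonnegative one.** With `|Θ| = Ψ₀`,
`|Θ + Ψ₀| = r₁ Ψ₀` and `|Θ + i Ψ₀| = r₂ Ψ₀` a.e. (`ae_eq_of_nonneg`, `exists_norm_add_eq`), the
quotient `Θ/Ψ₀` has modulus `1`, real part `(r₁² − 2)/2` and imaginary part `(r₂² − 2)/2`
wherever `Ψ₀ > 0`; so `Θ = c Ψ₀` a.e., and `|c| = 1` because `Ψ₀` is not a.e. zero.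
[cite: ReedSimonIV1978, §XIII.12 Thm XIII.44] -/
theorem exists_ae_eq_const_mul {Ψ₀ : Config N → ℝ} (hΨ₀0 : ∀ X, 0 ≤ Ψ₀ X)
    (hΨ₀ : IsGroundState v L (fun X => (Ψ₀ X : ℂ))) {Θ : Config N → ℂ}
    (hΘ : IsGroundState v L Θ) :
    ∃ c : ℂ, ‖c‖ = 1 ∧ ∀ᵐ X : Config N, Θ X = c * Ψ₀ X := by
  have h0 : ∀ᵐ X : Config N, ‖Θ X‖ = Ψ₀ X :=
    ae_eq_of_nonneg hlin hpos (P := fun X => ‖Θ X‖) (fun X => norm_nonneg _) hΨ₀0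
      (isGroundState_modulus hΘ) hΨ₀
  obtain ⟨r₁, h1⟩ := exists_norm_add_eq hlin hpos hΨ₀0 hΨ₀ hΘ (u := 1) (by simp)
  obtain ⟨r₂, h2⟩ := exists_norm_add_eq hlin hpos hΨ₀0 hΨ₀ hΘ (u := Complex.I) (by simp)
  set c : ℂ := (((r₁ ^ 2 - 2) / 2 : ℝ) : ℂ) + (((r₂ ^ 2 - 2) / 2 : ℝ) : ℂ) * Complex.I
    with hc_def
  have hae : ∀ᵐ X : Config N, Θ X = c * Ψ₀ X := by
    filter_upwards [h0, h1, h2] with X e0 e1 e2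
    rcases (hΨ₀0 X).eq_or_lt with hp | hp
    · have hz : Θ X = 0 := norm_eq_zero.1 (e0.trans hp.symm)
      rw [hz, ← hp]
      simp
    · have n0 : ‖Θ X‖ ^ 2 = (Θ X).re ^ 2 + (Θ X).im ^ 2 := by
        rw [Complex.sq_norm, Complex.normSq_apply]; ring
      have n1 : ‖Θ X + 1 * (Ψ₀ X : ℂ)‖ ^ 2 = ((Θ X).re + Ψ₀ X) ^ 2 + (Θ X).im ^ 2 := by
        rw [Complex.sq_norm, Complex.normSq_apply]
        simp only [Complex.add_re, Complex.add_im, Complex.mul_re, Complex.mul_im,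
          Complex.one_re, Complex.one_im, Complex.ofReal_re, Complex.ofReal_im]
        ring
      have n2 : ‖Θ X + Complex.I * (Ψ₀ X : ℂ)‖ ^ 2 = (Θ X).re ^ 2 + ((Θ X).im + Ψ₀ X) ^ 2 := by
        rw [Complex.sq_norm, Complex.normSq_apply]
        simp only [Complex.add_re, Complex.add_im, Complex.mul_re, Complex.mul_im,
          Complex.I_re, Complex.I_im, Complex.ofReal_re, Complex.ofReal_im]
        ring
      rw [e0] at n0
      rw [e1] at n1
      rw [e2] at n2
      have h2p : (2 * Ψ₀ X) ≠ 0 := mul_ne_zero two_ne_zero hp.ne'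
      have hre : (Θ X).re = (r₁ ^ 2 - 2) / 2 * Ψ₀ X := by
        refine mul_left_cancel₀ h2p ?_
        linear_combination n0 - n1
      have him : (Θ X).im = (r₂ ^ 2 - 2) / 2 * Ψ₀ X := by
        refine mul_left_cancel₀ h2p ?_
        linear_combination n0 - n2
      apply Complex.ext
      · simp only [hc_def, Complex.add_re, Complex.mul_re, Complex.ofReal_re, Complex.ofReal_im,
          Complex.I_re, Complex.I_im]
        rw [hre]
        ring
      · simp only [hc_def, Complex.add_im, Complex.mul_re, Complex.mul_im, Complex.ofReal_re,
          Complex.ofReal_im, Complex.I_re, Complex.I_im, Complex.add_re]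
        rw [him]
        ring
  refine ⟨c, ?_, hae⟩
  by_contra hc
  refine not_ae_eq_zero hΨ₀ ?_
  filter_upwards [h0, hae] with X e0 e1
  by_contra hne
  have hp : Ψ₀ X ≠ 0 := fun h => hne (by simp [h])
  apply hc
  rw [e1, norm_mul, Complex.norm_real, Real.norm_of_nonneg (hΨ₀0 X)] at e0
  exact (mul_eq_right₀ hp).1 e0

end Lincomb

end UniqueOfPos

/-! ### The stub -/

open UniqueOfPos in
/-- **Stub `stub_uniqueOfPos` of line `Sketch` — uniqueness up to phase from a.e. positivity of
nonnegative ground states (every `v`).** Given, as hypotheses, that normalised linear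
combinations of ground states are ground states (the registered statement of
`stub_lincombGroundState`) and that every nonnegative ground state is a.e. strictly positive on
the box, the existence of one nonnegative ground state gives `HasUniqueGroundState v N L`:
by the lattice/sign argument on the cone of minimisers (`|Θ|` is a ground state; real ground
states have a strict sign a.e. on the box; two nonnegative ground states agree a.e.) every ground
state is `c Ψ₀` a.e. with `|c| = 1` (`UniqueOfPos.exists_ae_eq_const_mul`), so two ground states
`c₁ Ψ₀`, `c₂ Ψ₀` differ by the constant phase `c₂ conj c₁`.
[cite: ReedSimonIV1978, §XIII.12 Thm XIII.44] -/
theorem stub_uniqueOfPos :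
    (∀ (N : ℕ) (v : ℝ → ℝ≥0∞) (L : ℝ) (Ψ Φ : Config N → ℂ) (a b : ℂ),
      IsGroundState v L Ψ → IsGroundState v L Φ →
      ∫⁻ X, (‖a * Ψ X + b * Φ X‖₊ : ℝ≥0∞) ^ 2 = 1 →
      IsGroundState v L (fun X => a * Ψ X + b * Φ X)) →
    ∀ (N : ℕ) (v : ℝ → ℝ≥0∞) (L : ℝ),
      (∃ Ψ₀ : Config N → ℝ, (∀ X, 0 ≤ Ψ₀ X) ∧ IsGroundState v L (fun X => (Ψ₀ X : ℂ))) →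
      (∀ Ψ₀ : Config N → ℝ, (∀ X, 0 ≤ Ψ₀ X) → IsGroundState v L (fun X => (Ψ₀ X : ℂ)) →
        ∀ᵐ X : Config N, X ∈ boxN N L → 0 < Ψ₀ X) →
      HasUniqueGroundState v N L := by
  intro hlin N v L hex hpos
  refine ⟨hex, fun Ψ Φ hΨ hΦ => ?_⟩
  obtain ⟨Ψ₀, hΨ₀0, hΨ₀⟩ := hex
  obtain ⟨c₁, hc₁, h₁⟩ := exists_ae_eq_const_mul hlin hpos hΨ₀0 hΨ₀ hΨ
  obtain ⟨c₂, hc₂, h₂⟩ := exists_ae_eq_const_mul hlin hpos hΨ₀0 hΨ₀ hΦ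
  refine ⟨c₂ * conj c₁, by rw [norm_mul, Complex.norm_conj, hc₁, hc₂, mul_one], ?_⟩
  filter_upwards [h₁, h₂] with X e₁ e₂
  rw [e₂, e₁, mul_assoc, ← mul_assoc (conj c₁), Complex.conj_mul', hc₁]
  simp

end Summit.AtomisticToContinuum.BoseEinsteinCondensation.Theorems.GroundStateRigidity

end
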